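import Mathlib
import Summits.NavierStokesRegularity.NavierStokesRegularity.Theorems.LerayQuarterDissipationFiniteDissipationLiouvilleCriticalProductionBorderline
import HarnessLib

/-!
# Crux `FiniteDissipationLiouville` (stmt-NavierStokesRegularity-22144): THE BARE BORDERLINE `a = 1` IS
# EQUIVALENT TO THE NON-EXISTENCE OF CONSTANT-MODULUS VORTICITY PROFILES

Theorems file of route `LerayQuarterDissipation` (lead prover g19; `--supports` the crux; sequel of
`…CriticalProductionBorderline`). Navier–Stokes regularity is NOT proved by anything here; no summit is.

* `subsolution_of_constModulus` — a profile of the KNSS-gauge Type-I class with `t²‖curl W‖² ≡ M` satisfies the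
  borderline sub-solution property (indeed with equality, `…borderline_identity_of_constModulus`);
* **`borderline_iff_no_constModulus`** — for every Type-I constant `C`: «every KNSS-gauge Type-I field with
  constant `C` whose `t²|ω|²` is a sub-solution of `∂ₜ + u·∇ − Δ` vanishes identically» ⟺ «no KNSS-gauge Type-I
  field with constant `C` has vorticity of spatially constant modulus `√M/(−t)`, `M > 0`». The open census item
  (lead g18, bare borderline `a = 1`) is thus EXACTLY the exclusion of constant-modulus-vorticity profiles —
  fields with nowhere-vanishing vorticity, everywhere super-critical stretching along the vorticity
  (`…one_le_stretching_of_constModulus`), Type-I vorticity blow-up at every point of the final slice, and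
  infinite dissipation on every slice (`…not_law_of_constModulus`).

HONEST FRAMING. A reformulation of an open sub-question about a HYPOTHETICAL class; neither side is proved.
Nothing is removed from the DSS wall (`∀ c>1 TypeIDSSLiouville c`, NECESSARY for the crux). Nothing here
bears on Navier–Stokes regularity.
-/

noncomputable section

set_option linter.dupNamespace false

namespace Summit.NavierStokesRegularity.NavierStokesRegularity.Theorems.FiniteDissipationLiouville.CriticalProduction

open MeasureTheory Set Function Filter Topology TopologicalSpace Metric InnerProductSpace
open scoped RealInnerProductSpace InnerProductSpace Laplacian ContDiff
open Literature.Analysis Literature.Analysis.FluidPDE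
open Summit.NavierStokesRegularity.NavierStokesRegularity.Theorems

variable {C : ℝ}

/-- A constant-modulus profile satisfies the borderline sub-solution property. [folklore] -/
theorem subsolution_of_constModulus {W : ℝ → EuclideanSpace ℝ (Fin 3) → EuclideanSpace ℝ (Fin 3)} {M : ℝ}
    (hW : IsTypeIAncientMild C W) (hM : ∀ t < 0, ∀ x, t ^ 2 * ⟪curl (W t) x, curl (W t) x⟫_ℝ = M) :
    ∀ s < 0, ∀ y, (-s) * (⟪curl (W s) y, fderiv ℝ (W s) y (curl (W s) y)⟫_ℝ
        - frobeniusNormSq (fderiv ℝ (curl (W s)) y)) ≤ ⟪curl (W s) y, curl (W s) y⟫_ℝ :=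
  fun s hs y => (borderline_identity_of_constModulus hW hM s hs y).le

/-- **THE BARE BORDERLINE ⟺ NO CONSTANT-MODULUS VORTICITY PROFILES.** See the module docstring.
[cite: KochNadirashviliSereginSverak2009, Prop. 4.1 and Lemma 3.1 (arXiv:0709.3599)] -/
theorem borderline_iff_no_constModulus (C : ℝ) :
    (∀ V : ℝ → EuclideanSpace ℝ (Fin 3) → EuclideanSpace ℝ (Fin 3), IsTypeIAncientMild C V →
      (∀ s < 0, ∀ y, (-s) * (⟪curl (V s) y, fderiv ℝ (V s) y (curl (V s) y)⟫_ℝ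
        - frobeniusNormSq (fderiv ℝ (curl (V s)) y)) ≤ ⟪curl (V s) y, curl (V s) y⟫_ℝ) →
      ∀ t < 0, ∀ x, V t x = 0) ↔
    (∀ (W : ℝ → EuclideanSpace ℝ (Fin 3) → EuclideanSpace ℝ (Fin 3)) (M : ℝ), IsTypeIAncientMild C W →
      0 < M → (∀ t < 0, ∀ x, t ^ 2 * ⟪curl (W t) x, curl (W t) x⟫_ℝ = M) → False) := by
  constructor
  · intro h W M hW hMpos hM
    have hW0 := h W hW (subsolution_of_constModulus hW hM)
    have hslice : W (-1) = fun _ => 0 := funext fun x => hW0 (-1) (by norm_num) x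
    have hc0 : curl (W (-1)) 0 = 0 := by rw [curl_eq_curlCLM, hslice]; simp
    have h1 := hM (-1) (by norm_num) 0
    rw [hc0, inner_zero_left, mul_zero] at h1
    exact hMpos.ne' h1.symm |>.elim
  · intro h V hV hsub
    rcases subsolution_dichotomy hV hsub with h0 | ⟨W, M, hW, hMpos, -, hM⟩
    · exact h0
    · exact (h W M hW hMpos hM).elim

end Summit.NavierStokesRegularity.NavierStokesRegularity.Theorems.FiniteDissipationLiouville.CriticalProduction

end
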